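import Mathlib
import Summits.Ventures.HodgeRepro.Tier4.Common.Adelic
import Summits.Ventures.HodgeRepro.Tier4.Common.AdelicDefs

/-!
# Tier4/Common/AdelicRTF — the kernel, the right regular action, the toric periods, the `ℂ`-linear period
functionals, `J` and the orbital integrals as Mathlib sums and integrals on the DEFINED adelic groups (Adelic v0.4,
(D2) of the lead's ruling S12038), and the instantiation of the v0.3 interface `AdelicPair`

Blind re-derivation cell `pub-hodge-repro`, Tier 4 (README §9–§10), seat t4-typer-2 (gen 0).  Target tree path
`lean/Summits/Ventures/HodgeRepro/Tier4/Common/AdelicRTF.lean`.  Imports `Tier4/Common/AdelicDefs.lean` ((D1): `GA W`,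
`rationalPoints`, `torusT`, `torusT'`, `centre`, `rationalOf`) and the landed interface `Tier4/Common/Adelic.lean`.

(D2) THE ANALYSIS, with the ONE Mathlib limit stated honestly: a Haar measure on `unitaryGroup W` needs
`LocallyCompactSpace 𝔸_k`, which this Mathlib does not have (the finite adeles' local compactness is only the
criterion `Valued.LocallyCompact`, never instantiated for number fields).  So the Haar measure `μ` and the
fundamental domains `D_T ⊂ T`, `D_{T′} ⊂ T′` for the rational points are PARAMETERS with Mathlib's DEFINED predicates
`μ.IsHaarMeasure` and `MeasureTheory.IsFundamentalDomain`, and on top of them everything is a definition: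
`kernel f x y := ∑' γ : rationalPoints, f (x⁻¹ γ y)`, `rightRegular μ f φ x := ∫ y, f y * φ (x y) ∂μ`,
`toricPeriod μ_T D χ F := ∫ t in D, χ t * F t ∂μ_T`, the `ℂ`-LINEAR period functional `periodLin` (the integral on the
integrable functions, extended linearly by `LinearMap.ofIsCompl` on a complement — the honest «junk elsewhere» of
`AdelicPair.periodT`), `J`, and the double-coset orbital integral `orbital`.  `AdelicPair.ofDefs` packs the defined
objects into the v0.3 interface, so every statement a line wrote against `AdelicPair GA` applies to the defined
objects by name.

Nothing here is a theorem about the intended objects beyond the definitional identities recorded; nothing here says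
anything about the status of the Hodge conjecture for CM abelian varieties, which is NOT proved (HC_CM is NOT proved
by anyone in this repository).
-/

set_option autoImplicit false

noncomputable section

namespace Summit.Ventures.HodgeRepro.Tier4.Common

open NumberField Matrix
open scoped NumberField

/-! ## (D2) The analysis: kernel, right regular action, toric periods, `J`, orbital integrals -/

section Analysis

open MeasureTheory

variable {k : Type} [Field k] [NumberField k] (W : PlaneData k)

/-- **The kernel** `K_f(x, y) = Σ_{γ ∈ G(k)} f(x⁻¹ γ y)` (a `tsum` over the rational points; `0` where the family is
not summable, the junk value of Mathlib's `tsum`). -/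
def kernel (f : GA W → ℂ) (x y : GA W) : ℂ := ∑' γ : rationalPoints W, f (x⁻¹ * (γ : GA W) * y)

/-- **The right regular action** `(R(f) φ)(x) = ∫ f(y) φ(x y) dμ(y)` for a measure `μ` on `G(𝔸_k)`. -/
def rightRegular [MeasurableSpace (GA W)] (μ : Measure (GA W)) (f φ : GA W → ℂ) (x : GA W) : ℂ :=
  ∫ y, f y * φ (x * y) ∂μ

/-- A test function: continuous with compact support (the adelic `C_c^∞` is continuous + compactly supported +
locally constant at the finite places; the first two are the defined predicate used here). -/
def IsTestFn (f : GA W → ℂ) : Prop := Continuous f ∧ HasCompactSupport f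

variable {S : Subgroup (GA W)} [MeasurableSpace S]

/-- **The toric period** of `F` against the character `χ` over the fundamental domain `D ⊂ S` of the rational points:
`∫_D χ(t) F(t) dμ_S(t)`. -/
def toricPeriod (μS : Measure S) (D : Set S) (χ : S → ℂ) (F : S → ℂ) : ℂ := ∫ t in D, χ t * F t ∂μS

/-- The functions `F` with `χ · F` integrable over `D`: a `ℂ`-subspace. -/
def integrableSub (μS : Measure S) (D : Set S) (χ : S → ℂ) : Submodule ℂ (S → ℂ) where
  carrier := {F | Integrable (fun t => χ t * F t) (μS.restrict D)}
  zero_mem' := by simp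
  add_mem' := by
    intro F G hF hG
    simp only [Set.mem_setOf_eq, Pi.add_apply, mul_add] at *
    exact hF.add hG
  smul_mem' := by
    intro c F hF
    simp only [Set.mem_setOf_eq, Pi.smul_apply, smul_eq_mul] at *
    have : (fun t => χ t * (c * F t)) = fun t => c * (χ t * F t) := by funext t; ring
    rw [this]
    exact hF.const_mul c

/-- The toric period as a linear map on the integrable subspace. -/
def periodLinOn (μS : Measure S) (D : Set S) (χ : S → ℂ) : integrableSub W μS D χ →ₗ[ℂ] ℂ where
  toFun F := toricPeriod W μS D χ F
  map_add' := by
    intro F G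
    simp only [toricPeriod, Submodule.coe_add, Pi.add_apply, mul_add]
    exact integral_add F.2 G.2
  map_smul' := by
    intro c F
    simp only [toricPeriod, Submodule.coe_smul, Pi.smul_apply, smul_eq_mul, RingHom.id_apply]
    have : (fun t => χ t * (c * (F : S → ℂ) t)) = fun t => c * (χ t * (F : S → ℂ) t) := by funext t; ring
    rw [this]
    exact integral_const_mul c _

/-- A complement of the integrable subspace (chosen once, classically). -/
def integrableCompl (μS : Measure S) (D : Set S) (χ : S → ℂ) : Submodule ℂ (S → ℂ) :=
  Classical.choose (integrableSub W μS D χ).exists_isCompl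

/-- The chosen complement is a complement. -/
theorem isCompl_integrableCompl (μS : Measure S) (D : Set S) (χ : S → ℂ) :
    IsCompl (integrableSub W μS D χ) (integrableCompl W μS D χ) :=
  Classical.choose_spec (integrableSub W μS D χ).exists_isCompl

/-- **The `ℂ`-linear period functional**: the toric period on the integrable functions, extended by `0` on a chosen
complement (`LinearMap.ofIsCompl`) — the «linear functional agreeing with `∫_{[T]} χ(t) · dt` on the integrable
functions, junk elsewhere» of the v0.3 interface. -/
def periodLin (μS : Measure S) (D : Set S) (χ : S → ℂ) : (S → ℂ) →ₗ[ℂ] ℂ :=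
  LinearMap.ofIsCompl (isCompl_integrableCompl W μS D χ) (periodLinOn W μS D χ) 0

/-- On an integrable function the linear period IS the toric period. -/
theorem periodLin_apply_of_mem (μS : Measure S) (D : Set S) (χ : S → ℂ) {F : S → ℂ}
    (hF : F ∈ integrableSub W μS D χ) : periodLin W μS D χ F = toricPeriod W μS D χ F := by
  unfold periodLin
  exact LinearMap.ofIsCompl_apply_left (isCompl_integrableCompl W μS D χ) (φ := periodLinOn W μS D χ) (ψ := 0) ⟨F, hF⟩

/-- On a function with `χ · F` integrable over `D` the linear period is the integral. -/
theorem periodLin_eq_integral (μS : Measure S) (D : Set S) (χ : S → ℂ) {F : S → ℂ}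
    (hF : Integrable (fun t => χ t * F t) (μS.restrict D)) :
    periodLin W μS D χ F = ∫ t in D, χ t * F t ∂μS :=
  periodLin_apply_of_mem W μS D χ hF

end Analysis

/-! ## The relative-trace-formula data, defined, and the instantiation of the v0.3 interface -/

section RTF

open MeasureTheory

variable {k : Type} [Field k] [NumberField k] (W : PlaneData k)
  [MeasurableSpace (torusT W)] [MeasurableSpace (torusT' W)]

/-- **The data of the relative trace formula on the defined groups**: the two characters `χ`, `χ′` (characters of the
adelic tori, trivial on the rational points, agreeing on the centre — N2), the measures on the tori and the
fundamental domains of their rational points (Mathlib's `IsFundamentalDomain` for the left action of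
`rationalOf W S` on `S`). -/
structure RTFData where
  /-- the character `χ = χ₀ ⊗ χ₁` of `T(𝔸_k)` -/
  chi : torusT W → ℂ
  /-- the character `χ′ = χ₂ ⊗ χ₃` of `T′(𝔸_k)` -/
  chi' : torusT' W → ℂ
  /-- `χ` is a character -/
  chi_mul : ∀ s t : torusT W, chi (s * t) = chi s * chi t
  /-- `χ′` is a character -/
  chi'_mul : ∀ s t : torusT' W, chi' (s * t) = chi' s * chi' t
  /-- `χ` is trivial on `T(k)` -/
  chi_rational : ∀ t : torusT W, (t : GA W) ∈ rationalPoints W → chi t = 1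
  /-- `χ′` is trivial on `T′(k)` -/
  chi'_rational : ∀ t : torusT' W, (t : GA W) ∈ rationalPoints W → chi' t = 1
  /-- N2: `χ = χ′` on the centre -/
  chi_centre : ∀ (z : GA W) (hz : z ∈ centre W),
    chi ⟨z, centre_le_torusT W hz⟩ = chi' ⟨z, centre_le_torusT' W hz⟩
  /-- the measure on `T(𝔸_k)` -/
  μT : Measure (torusT W)
  /-- the measure on `T′(𝔸_k)` -/
  μT' : Measure (torusT' W)
  /-- a fundamental domain of `T(k)` in `T(𝔸_k)` -/
  DT : Set (torusT W)
  /-- a fundamental domain of `T′(k)` in `T′(𝔸_k)` -/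
  DT' : Set (torusT' W)
  /-- `DT` is a fundamental domain for the left action of the rational points (Mathlib's predicate) -/
  DT_fund : IsFundamentalDomain (rationalOf W (torusT W)) DT μT
  /-- `DT′` is a fundamental domain for the rational points -/
  DT'_fund : IsFundamentalDomain (rationalOf W (torusT' W)) DT' μT'

namespace RTFData

variable {W} (R : RTFData W)

/-- The linear period functional `P_χ` on functions of `T(𝔸_k)`. -/
def periodT : (torusT W → ℂ) →ₗ[ℂ] ℂ := periodLin W R.μT R.DT R.chi

/-- The linear period functional `P_{χ′}` on functions of `T′(𝔸_k)`. -/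
def periodT' : (torusT' W → ℂ) →ₗ[ℂ] ℂ := periodLin W R.μT' R.DT' R.chi'

/-- **The distribution `J(f)`** of the relative trace formula: `P_χ (t ↦ P_{χ′} (t′ ↦ K_f(t, t′)))`. -/
def J (f : GA W → ℂ) : ℂ := R.periodT fun t => R.periodT' fun t' => kernel W f (t : GA W) (t' : GA W)

/-- **The double-coset orbital integral** `O_γ(f) = ∫_{[T]} ∫_{[T′]} f(t⁻¹ γ t′) χ(t) χ′(t′) dt′ dt`. -/
def orbital (γ : GA W) (f : GA W → ℂ) : ℂ :=
  R.periodT fun t => R.periodT' fun t' => f ((t : GA W)⁻¹ * γ * (t' : GA W))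

/-- **The instantiation of the v0.3 interface by the defined objects**: `AdelicPair (GA W)` with the rational
points, the tori, the characters, the centre, all test functions (`TestFn := GA W → ℂ`, `eval := id`), the defined
kernel and the two linear period functionals. -/
def toAdelicPair : AdelicPair (GA W) where
  Gk := rationalPoints W
  T := torusT W
  T' := torusT' W
  chi := R.chi
  chi' := R.chi'
  chi_mul := R.chi_mul
  chi'_mul := R.chi'_mul
  chi_rational := R.chi_rational
  chi'_rational := R.chi'_rational
  Z := centre W
  Z_le_T := centre_le_torusT W
  Z_le_T' := centre_le_torusT' W
  chi_center := R.chi_centre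
  TestFn := GA W → ℂ
  eval := id
  kernel := kernel W
  periodT := R.periodT
  periodT' := R.periodT'

/-- The interface's `J` is the defined `J`. -/
theorem toAdelicPair_J (f : GA W → ℂ) : R.toAdelicPair.J f = R.J f := rfl

/-- The interface's kernel is the defined kernel. -/
theorem toAdelicPair_kernel (f : GA W → ℂ) (x y : GA W) : R.toAdelicPair.kernel f x y = kernel W f x y := rfl

end RTFData

end RTF

/-! ## Convention correction (t4-plan-1 S12125 (4)): the `T′`-side character enters CONJUGATED

`J f = ∫∫ K_f(t, t′) χ(t) χ′(t′)` (the definitions above) is invariant under `(t, t′) ↦ (z t, z t′)` for central `z`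
(`K_f` does not see `z`), so it picks up the factor `χ(z) χ′(z) = χ(z)²` (N2: `χ = χ′` on `Z`) and VANISHES
identically unless `χ² = 1` on `[Z]` — not the distribution of the relative trace formula.  The correct convention
conjugates the `T′`-side character: `J f = ∫∫ K_f(t, t′) χ(t) conj χ′(t′)`, whose central factor is
`χ(z) conj χ′(z) = |χ(z)|² = 1` for unitary `χ`, matching the spectral side `Σ_φ P_χ(R(f) φ) · conj P_{χ′}(φ)`.
The definitions below (`periodT'conj`, `Jc`, `orbitalc`, `toAdelicPairConj`) are the ones a line should use; the
unconjugated `J` / `orbital` / `toAdelicPair` above are kept only because the file is append-only. -/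

section Conj

open MeasureTheory
open scoped ComplexConjugate

variable {k : Type} [Field k] [NumberField k] {W : PlaneData k}
  [MeasurableSpace (torusT W)] [MeasurableSpace (torusT' W)] (R : RTFData W)

namespace RTFData

/-- The conjugate character `conj ∘ χ′` of `T′(𝔸_k)`. -/
def chi'conj : torusT' W → ℂ := fun t => conj (R.chi' t)

/-- The linear period functional `P_{conj χ′}` on functions of `T′(𝔸_k)`. -/
def periodT'conj : (torusT' W → ℂ) →ₗ[ℂ] ℂ := periodLin W R.μT' R.DT' R.chi'conj

/-- **The distribution `J(f)` of the relative trace formula, correct convention**: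
`P_χ (t ↦ P_{conj χ′} (t′ ↦ K_f(t, t′)))`. -/
def Jc (f : GA W → ℂ) : ℂ := R.periodT fun t => R.periodT'conj fun t' => kernel W f (t : GA W) (t' : GA W)

/-- **The double-coset orbital integral, correct convention**:
`O_γ(f) = ∫_{[T]} ∫_{[T′]} f(t⁻¹ γ t′) χ(t) conj χ′(t′) dt′ dt`. -/
def orbitalc (γ : GA W) (f : GA W → ℂ) : ℂ :=
  R.periodT fun t => R.periodT'conj fun t' => f ((t : GA W)⁻¹ * γ * (t' : GA W))

/-- **The instantiation of the v0.3 interface in the correct convention**: the characters are `χ`, `χ′` (so the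
interface's `chi_center` is N2 verbatim), and the `T′`-side linear period functional is `P_{conj χ′}` — the
interface's `periodT'` slot is «the linear functional integrating the `T′`-side» and the RTF convention puts the
conjugate character there — so that the interface's `J` IS `Jc` (`toAdelicPairConj_J`). -/
def toAdelicPairConj : AdelicPair (GA W) where
  Gk := rationalPoints W
  T := torusT W
  T' := torusT' W
  chi := R.chi
  chi' := R.chi'
  chi_mul := R.chi_mul
  chi'_mul := R.chi'_mul
  chi_rational := R.chi_rational
  chi'_rational := R.chi'_rational
  Z := centre W
  Z_le_T := centre_le_torusT W
  Z_le_T' := centre_le_torusT' W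
  chi_center := R.chi_centre
  TestFn := GA W → ℂ
  eval := id
  kernel := kernel W
  periodT := R.periodT
  periodT' := R.periodT'conj

/-- The interface's `J` in the correct convention is `Jc`. -/
theorem toAdelicPairConj_J (f : GA W → ℂ) : R.toAdelicPairConj.J f = R.Jc f := rfl

/-- The interface's `periodT'` in the correct convention is `P_{conj χ′}`. -/
theorem toAdelicPairConj_periodT' : R.toAdelicPairConj.periodT' = R.periodT'conj := rfl

/-- `Jc` is the iterated period of the kernel, unfolded. -/
theorem Jc_def (f : GA W → ℂ) :
    R.Jc f = R.periodT fun t => R.periodT'conj fun t' => kernel W f (t : GA W) (t' : GA W) := rfl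

end RTFData

end Conj



/-! ## v0.3 (append, documentation only — no declaration changed): THE DICTIONARY OF RECORD for the characters of
an `RTFData` (t4-plan-4 S12948 (3), t4-typer-2 S12929 / S12954; ruling by the Common owner, 2026-08-28T22:1xZ)

The four `U(1)`-characters `μ₀, μ₁, μ₂, μ₃` of the face's corners give, after the mixed transfer, the classes
`ξ₀₂ = ω₀ ∧ conj ω₂` (character `μ₀ μ̄₂` on the first torus `T`) and `ξ₁₃ = ω₁ ∧ conj ω₃` (character `μ₁ μ̄₃` on the
second torus `T′`).  The seesaw term is BILINEAR, `∑_{f ∈ ONB(V)} conj(P_{χ̄₀₂}(f)) · P_{χ₁₃}(f) = P_{χ̄₀₂}(v_{χ₁₃})`,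
with `v_{χ₁₃}` the Riesz vector of `P_{χ₁₃}`, which is `χ̄₁₃`-EQUIVARIANT.  Matching this with the mixed-period clause
«`P_χ(v′) ≠ 0`, `v′` `χ̄′`-equivariant» (LINE L4's wall, `Tier4/Line4/TwoTorusCut`) fixes the reading of the two fields:

* **`RTFData.chi` = the character of `conj ξ₀₂` on `T`: `χ = μ̄₀ μ₂`;**
* **`RTFData.chi'` = the character of `ξ₁₃` on `T′`: `χ′ = μ₁ μ̄₃`.**

Under this dictionary the central-consistency field `chi_centre` (N2: `χ = χ′` on `centre W`) reads `μ̄₀ μ₂ = μ₁ μ̄₃`,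
i.e. (unitary) `μ₀ μ₁ = μ₂ μ₃` on the scalars — exactly «`ψ := μ₀μ₁μ̄₂μ̄₃ ≡ 1`», the central condition of the
target's integrand.  N2 is FORCED by the mixed-period clause (`Tier4/Common/CentralConsistency`:
`chi_eq_of_periodLin_ne_zero`, `mixedPeriod_eq_zero_of_chi_ne`).

`RTFData.J` above integrates the UN-conjugated `χ′` in the `T′`-slot: its spectral side pairs `P_χ(φ)` with
`conj P_{χ̄′}(φ)`, whose Riesz vector is `χ′`-equivariant — the other locus (`χ · χ′ = 1` on the centre).  LINE L4 does
not use `J`; a consumer of the two-torus RTF in the (C4)-dictionary takes `J` with `conjChar chi'` in the `T′`-slot. -/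

end Summit.Ventures.HodgeRepro.Tier4.Common

end
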